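import Literature.Probability.RandomPlanarGeometry.SAWRestrictionCovariance
import Literature.Probability.RandomPlanarGeometry.SAWEdgeListSurgery
import Literature.Probability.RandomPlanarGeometry.PolylineShellTraversals
import Literature.Probability.RandomPlanarGeometry.CurveTortuosity
import Literature.Probability.LatticeModels.MeshDomainJordan
import Literature.Probability.LatticeModels.LatticeDobrushinDomain
import HarnessLib

/-!
# Eventual tightness of the critical planar SAW laws — V3: the cut configuration is virgin

Stub V3 `stub_virginConfig` of line `Sketch` (registration v6) for the crux
`SAWRenewalTightness.EventualTight` / `SAWRestrictionRigidity.EventualTight`.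

Let `D` be a Dobrushin domain with carrier `Ω`, and let `B̄(y, R_c + e) ⊆ Ω` with `R_c, e > 0`.
For every mesh `δ ∈ (0, δ₃]` (`δ₃ = min e (δ₀/2)`, `δ₀` the threshold of
`JordanDomain.exists_forall_mem_meshDomain_and_reachable` for the compact `K = B̄(y, R_c + e)`),
with lattice centre `z₀ = y/δ` and lattice radius `N = R_c/δ`, cut the vertex sequence of a
self-avoiding walk `γ` of `Ω_δ` as `β ++ α ++ β'` with `β`, `β'` strictly outside the circle of
radius `N` about `z₀` and `α` starting at `c`, ending at `c'`, both in the closed disc. Then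

1. the configuration `(Ω_δ, Λ)`, `Λ = {v | v ∉ β ∧ v ∉ β'}`, is VIRGIN at `(z₀, N)`: `Ω_δ ≤ ℤ²`, every
   lattice point of the closed `N`-disc is allowed, and every `ℤ²`-edge between lattice points of
   the closed `(N+1)`-disc is an edge of `Ω_δ` (both mesh points lie in the convex set `K ⊆ Ω`,
   hence in `meshDomain Ω δ` by the Jordan lemma, and the segment between them lies in
   `K ⊆ Ω ⊆ Ω̄`);
2. `(u, c)` and `(u', c')` (`u` the last vertex of `β`, `u'` the first of `β'`) are DOORS: they are
   consecutive vertices of the support chain, `u ∈ β`, `u' ∈ β'`, while `c, c' ∈ α` avoid `β`, `β'`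
   by duplicate-freeness of the support.

Folklore bookkeeping (Duminil-Copin–Smirnov 2012, §2, domain Markov property; the square-lattice
analogue of `HexSAWVirginizationCut.lean`). Anchors: `JordanDomain.exists_forall_mem_meshDomain_and_reachable`
(`MeshDomainJordan.lean`), `discreteDomainGraph_adj_iff`, `meshGraph_adj_iff`
(`DomainDiscretisation.lean`), Mathlib `isCompact_closedBall`, `convex_closedBall`,
`List.isChain_append`, `List.nodup_append`, `SimpleGraph.Walk.isChain_adj_support`.
-/

noncomputable section

open MeasureTheory Filter Topology Set Metric
open scoped ENNReal NNReal unitInterval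
open Literature.Probability.RandomPlanarGeometry Literature.Probability.LatticeModels

namespace Summit.CriticalPhenomena.SAWScalingLimit.Theorems

/-- The mesh point of `v` sits at distance `δ · dist(v, z₀)` from `y = δ z₀`. [folklore] -/
private theorem dist_meshPoint_eq_mul_virgin {δ : ℝ} (hδ : 0 < δ) {z₀ y : ℂ}
    (hz₀ : (δ : ℂ) * z₀ = y) (v : Site 2) :
    dist (meshPoint δ v) y = δ * dist (Site.toComplex v) z₀ := by
  rw [← hz₀, meshPoint, dist_eq_norm, dist_eq_norm, ← mul_sub, norm_mul, Complex.norm_real,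
    Real.norm_of_nonneg hδ.le]

/-- **V3 `stub_virginConfig`: the cut configuration is virgin and the cut edges are doors.**
For `B̄(y, R_c + e) ⊆ Ω` and every mesh `δ ∈ (0, δ₃]`, with `z₀ = y/δ`, `N = R_c/δ`: if the vertex
sequence of a SAW `γ` of `Ω_δ` is `β ++ α ++ β'` with `β`, `β'` strictly outside the circle
`dist(·, z₀) = N` and `α` from `c` to `c'` in the closed disc, then `Ω_δ ≤ ℤ²`, every lattice point
of the closed `N`-disc avoids `β` and `β'`, every `ℤ²`-edge of the closed `(N+1)`-disc is an
`Ω_δ`-edge, and `(u, c)`, `(u', c')` (`u` = last of `β`, `u'` = first of `β'`) are doors. See the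
module docstring. [folklore] -/
theorem stub_virginConfig :
    ∀ (D : DobrushinDomain) (y : ℂ) (Rc e : ℝ), 0 < Rc → 0 < e →
      Metric.closedBall y (Rc + e) ⊆ D.carrier →
      ∃ δ₃ : ℝ, 0 < δ₃ ∧ ∀ δ ∈ Set.Ioc (0 : ℝ) δ₃, ∀ (z₀ : ℂ) (N : ℝ),
        (δ : ℂ) * z₀ = y → δ * N = Rc →
        ∀ (a₀ b₀ : Site 2) (γ : SAW.DomainSAW D.carrier δ a₀ b₀)
          (β α β' : List (Site 2)) (c c' u u' : Site 2),
          γ.walk.support = β ++ α ++ β' → α.head? = some c → α.getLast? = some c' →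
          β.getLast? = some u → β'.head? = some u' →
          dist (Site.toComplex c) z₀ ≤ N → dist (Site.toComplex c') z₀ ≤ N →
          (∀ v ∈ β, N < dist (Site.toComplex v) z₀) →
          (∀ v ∈ β', N < dist (Site.toComplex v) z₀) →
          ((discreteDomainGraph D.carrier δ ≤ zdGraph 2 ∧
              (∀ v : Site 2, dist (Site.toComplex v) z₀ ≤ N → v ∈ {v : Site 2 | v ∉ β ∧ v ∉ β'}) ∧
              ∀ v v' : Site 2, dist (Site.toComplex v) z₀ ≤ N + 1 →
                dist (Site.toComplex v') z₀ ≤ N + 1 → (zdGraph 2).Adj v v' →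
                (discreteDomainGraph D.carrier δ).Adj v v') ∧
            ((discreteDomainGraph D.carrier δ).Adj u c ∧ u ∉ {v : Site 2 | v ∉ β ∧ v ∉ β'} ∧
              c ∈ {v : Site 2 | v ∉ β ∧ v ∉ β'} ∧ dist (Site.toComplex c) z₀ ≤ N ∧
              N < dist (Site.toComplex u) z₀) ∧
            ((discreteDomainGraph D.carrier δ).Adj u' c' ∧ u' ∉ {v : Site 2 | v ∉ β ∧ v ∉ β'} ∧
              c' ∈ {v : Site 2 | v ∉ β ∧ v ∉ β'} ∧ dist (Site.toComplex c') z₀ ≤ N ∧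
              N < dist (Site.toComplex u') z₀)) := by
  intro D y Rc e _ he hKΩ
  have hK : IsCompact (Metric.closedBall y (Rc + e)) := isCompact_closedBall y (Rc + e)
  obtain ⟨δ₀, hδ₀, hJ⟩ := D.toJordanDomain.exists_forall_mem_meshDomain_and_reachable hK hKΩ
  refine ⟨min e (δ₀ / 2), lt_min he (half_pos hδ₀), ?_⟩
  rintro δ ⟨hδ0, hδle⟩ z₀ N hz₀ hN a₀ b₀ γ β α β' c c' u u' hsupp hαh hαl hβl hβ'h hcN hc'N
    hβfar hβ'far
  have hδe : δ ≤ e := hδle.trans (min_le_left _ _)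
  have hδδ₀ : δ < δ₀ := (hδle.trans (min_le_right _ _)).trans_lt (half_lt_self hδ₀)
  -- lattice points with mesh point in `K` lie in the discrete domain
  have hin : ∀ x : Site 2, meshPoint δ x ∈ Metric.closedBall y (Rc + e) →
      x ∈ meshDomain D.carrier δ := (hJ δ hδ0 hδδ₀).1
  have hdist : ∀ v : Site 2, dist (meshPoint δ v) y = δ * dist (Site.toComplex v) z₀ :=
    dist_meshPoint_eq_mul_virgin hδ0 hz₀
  -- mesh points of the closed lattice `(N+1)`-disc lie in `K`
  have hmemK : ∀ v : Site 2, dist (Site.toComplex v) z₀ ≤ N + 1 →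
      meshPoint δ v ∈ Metric.closedBall y (Rc + e) := fun v hv => by
    rw [Metric.mem_closedBall, hdist]
    calc δ * dist (Site.toComplex v) z₀ ≤ δ * (N + 1) := mul_le_mul_of_nonneg_left hv hδ0.le
      _ = Rc + δ := by rw [mul_add, hN, mul_one]
      _ ≤ Rc + e := by linarith
  -- the support chain and its duplicate-freeness
  have hchain : List.IsChain (discreteDomainGraph D.carrier δ).Adj (β ++ α ++ β') := by
    rw [← hsupp]
    exact γ.walk.isChain_adj_support
  have hnodup : (β ++ α ++ β').Nodup := by
    rw [← hsupp]
    exact γ.isPath.support_nodup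
  have hcα : c ∈ α := List.mem_of_head? hαh
  have hc'α : c' ∈ α := List.mem_of_getLast? hαl
  have huβ : u ∈ β := List.mem_of_getLast? hβl
  have hu'β' : u' ∈ β' := List.mem_of_head? hβ'h
  rw [List.nodup_append] at hnodup
  obtain ⟨hnd₁, -, hdis₂⟩ := hnodup
  rw [List.nodup_append] at hnd₁
  obtain ⟨-, -, hdis₁⟩ := hnd₁
  have hcΛ : c ∉ β ∧ c ∉ β' :=
    ⟨fun h => hdis₁ c h c hcα rfl, fun h => hdis₂ c (List.mem_append_right β hcα) c h rfl⟩
  have hc'Λ : c' ∉ β ∧ c' ∉ β' :=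
    ⟨fun h => hdis₁ c' h c' hc'α rfl, fun h => hdis₂ c' (List.mem_append_right β hc'α) c' h rfl⟩
  -- the two cut edges are edges of `Ω_δ`
  have huc : (discreteDomainGraph D.carrier δ).Adj u c := by
    rw [List.append_assoc, List.isChain_append] at hchain
    exact hchain.2.2 u (by simp [hβl]) c (by simp [hαh])
  have hc'u' : (discreteDomainGraph D.carrier δ).Adj c' u' :=
    (List.isChain_append.1 hchain).2.2 c' (by simp [hαl]) u' (by simp [hβ'h])
  refine ⟨⟨(discreteDomainGraph_le_meshGraph _ _).trans (meshGraph_le_zdGraph _ _), ?_, ?_⟩,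
    ⟨huc, fun h => h.1 huβ, hcΛ, hcN, hβfar u huβ⟩,
    ⟨hc'u'.symm, fun h => h.2 hu'β', hc'Λ, hc'N, hβ'far u' hu'β'⟩⟩
  · -- every lattice point of the closed `N`-disc is allowed
    intro v hv
    exact ⟨fun h => absurd (hβfar v h) (not_lt.2 hv), fun h => absurd (hβ'far v h) (not_lt.2 hv)⟩
  · -- every lattice edge of the closed `(N+1)`-disc is an edge of `Ω_δ`
    intro v v' hv hv' hadj
    have hvK := hmemK v hv
    have hv'K := hmemK v' hv'
    refine discreteDomainGraph_adj_iff.2 ⟨meshGraph_adj_iff.2 ⟨hadj, ?_⟩, hin v hvK, hin v' hv'K⟩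
    exact ((convex_closedBall y (Rc + e)).segment_subset hvK hv'K).trans
      (hKΩ.trans subset_closure)

end Summit.CriticalPhenomena.SAWScalingLimit.Theorems

end
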